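import Literature.NumberTheory.Rogawski1990.FinExplicitTransferFactorInertPlaceUnramified      -- ★ B-p10∕B6-inert: `finKappaAt_eq_neg_one_of_nonsplit_of_isUnramifiedIn_of_odd'`
import Literature.NumberTheory.Rogawski1990.FinExplicitTransferFactorKappaEigenvector        -- ★ `localMatrix_mulVec_finEigenlineProjector_col`, `finKappaAt_eq_ite_of_eigenvector`
import Literature.NumberTheory.Rogawski1990.SingularLocalRealisation                         -- ★ `exists_toLocalRing_eq_of_conjLocal_eq`
import Literature.NumberTheory.Automorphic.LocalRegularOrbitClosed                           -- ★ `map_conjLocal_transpose_localForm`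
import HarnessLib

/-!
# `κ_v(γ_H, γ′) = +1` READ ON THE EIGENLINE: the `γ₂`-eigenvector of `γ′` exists, its `H′_v`-value descends to `L⁺_v`, and has EVEN order
(Rogawski (1990) §4.3 p. 43, §14.6 p. 242 «`κ(γ, ψ_v(i(γ)))` is `±1`»; O'Meara 63:16: at an unramified quadratic extension the norms are the elements of even order)

Topic `NumberTheory/Rogawski1990`; namespace `Literature.NumberTheory.Rogawski1990`.  THEOREMS ONLY (no definition, no named fact, no instance, no notation,
no `sorry`).  Cell `pub/hodgecm-mathlib`, crux H413 = `stmt-HodgeConjecture-24833`, road «N7-ns COUNT FROM FLICKER», line «N7nsCount», value stub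
`stub_irredGValuePos` (:1189, κ = +1): brick **(β)** of LEAD F0P3a-plan (g9) T8-131 — the reading «`κ_v(γH, δ) = +1` ⇒ the `u`-eigenline of `δ` has EVEN norm valuation,
and the eigenvector itself», in the stub's `G′_v` frame (B-p12 (g28)).  With (γ) (the transport `ψ`∕`Tl` to `U(Φ₃)(L_w)` and the `𝒪[L_w]` bridge) this feeds ★ B-p12
`natCard_fixedPoints_unitaryInt_eq_phiTHn_of_eigen` (p842182), whose `hx` is exactly «even norm valuation of the eigenvector».
HONEST LABEL: HC_CM is proved only modulo the printed citations (2 remaining named inputs hLiu418, h413) until rung 0 closes; bookkeeping, pays nothing by itself.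

* §1 `exists_eigenvector_of_finKappaAt_ne_zero` — on a matching pair with `κ_v ≠ 0` (so `P_v ≠ 0`), a non-zero COLUMN of `P_v = χ_g(γ′)` is a `γ₂`-eigenvector of `γ′`
  (★ `localMatrix_mulVec_finEigenlineProjector_col`).
* §2 `conjLocal_formValue_eq` ∕ `exists_toLocalRing_eq_formValue` — the `H′_v`-value `p′ᴴ H′_v p′` is `(c ⊗ 1)`-fixed (`H′_v` hermitian, ★ `map_conjLocal_transpose_localForm`),
  hence `= ι_v(x₀)` for some `x₀ ∈ L⁺_v` (★ `exists_toLocalRing_eq_of_conjLocal_eq`).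
* §3 **`formValue_ne_zero_of_finKappaAt_eq_one`**, **`even_log_valued_of_finKappaAt_eq_one`** — `κ_v = +1` forces `x₀ ≠ 0` (★ `finKappaAt_eq_ite_of_eigenvector`: a zero value
  is not a unit norm) and `ord_v x₀` EVEN (contrapositive of ★ `finKappaAt_eq_neg_one_of_nonsplit_of_isUnramifiedIn_of_odd'`).

## References
* [Rogawski1990] J. D. Rogawski, *Automorphic Representations of Unitary Groups in Three Variables*, Ann. of Math. Stud. 123 (1990): §4.3 p. 43, §4.9 p. 55, §14.6 p. 242.
* [Omeara1963] O. T. O'Meara, *Introduction to Quadratic Forms* (1963), §63C Example 63:16.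
-/

set_option autoImplicit false

noncomputable section

open NumberField IsDedekindDomain Matrix Polynomial
open scoped MatrixGroups

namespace Literature.NumberTheory.Rogawski1990

open Literature.NumberTheory.Automorphic Literature.NumberTheory.GaloisRepresentations Literature.NumberTheory.QuadraticForms
open Literature.NumberTheory.NumberFields

variable (L : Type) [Field L] [NumberField L] [IsCMField L] (v : HeightOneSpectrum (𝓞 ↥(maximalRealSubfield L)))
  (H' : Matrix (Fin 3) (Fin 3) L)
  (a : (UnitaryGroup.cmDatum L 2 (Matrix.of fun i j : Fin 2 => if i.val + j.val + 1 = 2 then (1 : L) else 0)).Local v ×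
      (UnitaryGroup.cmDatum L 1 (Matrix.of fun i j : Fin 1 => if i.val + j.val + 1 = 1 then (1 : L) else 0)).Local v)
  (b : (UnitaryGroup.cmDatum L 3 H').Local v)

/-- A CM field has `δ ≠ 0` with `cδ = −δ`. [folklore] -/
private theorem exists_complexConj_eq_neg_ne_zero₇ : ∃ δ : L, IsCMField.complexConj L δ = -δ ∧ δ ≠ 0 := by
  obtain ⟨ζ, hζ⟩ := not_forall.1 fun h0 => IsCMField.complexConj_ne_one L (AlgEquiv.ext h0)
  refine ⟨ζ - IsCMField.complexConj L ζ, by rw [map_sub, IsCMField.complexConj_apply_apply, neg_sub], fun h0 => hζ ?_⟩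
  rw [sub_eq_zero] at h0
  exact h0.symm

/-! ## §1 The eigenvector -/

open scoped Classical in
/-- **A `γ₂`-eigenvector of `γ′` from `P_v`**: on a matching pair with `κ_v(γ_H, γ′) ≠ 0` the projector `P_v = χ_g(γ′)` is non-zero, and each of its columns is a
`γ₂`-eigenvector of `γ′` (★ `localMatrix_mulVec_finEigenlineProjector_col`); a non-zero one exists. [cite: Rogawski1990, §4.9 p. 55; §4.3 p. 43] -/
theorem exists_eigenvector_of_finKappaAt_ne_zero (h : IsLocalNormPair L H' v a b) (hκ : finKappaAt L v H' a b ≠ 0) :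
    ∃ p' : Fin 3 → UnitaryGroup.LocalRing L v, p' ≠ 0 ∧
      (b.val.val : Matrix (Fin 3) (Fin 3) (UnitaryGroup.LocalRing L v)) *ᵥ p' = finGammaTwo L v a • p' := by
  have hP : finEigenlineProjector L v H' a b ≠ 0 := fun h0 => hκ (finKappaAt_of_projector_eq_zero L v H' a h0)
  obtain ⟨i, j, hij⟩ : ∃ i j : Fin 3, finEigenlineProjector L v H' a b i j ≠ 0 := by
    by_contra hc
    push Not at hc
    exact hP (Matrix.ext fun i j => hc i j)
  exact ⟨fun k => finEigenlineProjector L v H' a b k j, fun h0 => hij (by have := congrFun h0 i; simpa using this),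
    localMatrix_mulVec_finEigenlineProjector_col L v H' a b h j⟩

/-! ## §2 The `H′_v`-value of a vector descends to `L⁺_v` -/

/-- **`p′ᴴ H′_v p′` is `(c ⊗ 1)`-fixed** (`H′` hermitian ⇒ `H′_v` hermitian, ★ `map_conjLocal_transpose_localForm`). [cite: Rogawski1990, §3.1 p. 19; §4.3 p. 43] -/
theorem conjLocal_formValue_eq (hH' : (H'.map (cmConjRingHom L))ᵀ = H') (p' : Fin 3 → UnitaryGroup.LocalRing L v) :
    UnitaryGroup.conjLocal L (IsCMField.complexConj L) v
        (∑ i : Fin 3, ∑ k : Fin 3, UnitaryGroup.conjLocal L (IsCMField.complexConj L) v (p' i) *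
          ((UnitaryGroup.adelicForm L 3 H').map (UnitaryGroup.adeleToLocal L v)) i k * p' k) =
      ∑ i : Fin 3, ∑ k : Fin 3, UnitaryGroup.conjLocal L (IsCMField.complexConj L) v (p' i) *
        ((UnitaryGroup.adelicForm L 3 H').map (UnitaryGroup.adeleToLocal L v)) i k * p' k := by
  obtain ⟨δ, hcδ, hδ⟩ := exists_complexConj_eq_neg_ne_zero₇ L
  have hσσ : ∀ s, UnitaryGroup.conjLocal L (IsCMField.complexConj L) v (UnitaryGroup.conjLocal L (IsCMField.complexConj L) v s) = s :=
    Liu2021.LemD1OfPlace.conjLocal_conjLocal_apply L v (IsCMField.complexConj L) hcδ hδ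
  have hH := UnitaryGroup.map_conjLocal_transpose_localForm L 3 H' v hH'
  set Hv : Matrix (Fin 3) (Fin 3) (UnitaryGroup.LocalRing L v) := (UnitaryGroup.adelicForm L 3 H').map (UnitaryGroup.adeleToLocal L v) with hHv
  have hHik : ∀ i k : Fin 3, UnitaryGroup.conjLocal L (IsCMField.complexConj L) v (Hv i k) = Hv k i := by
    intro i k
    have := congrFun (congrFun hH k) i
    rw [Matrix.transpose_apply, Matrix.map_apply] at this
    exact this
  rw [map_sum]
  simp_rw [map_sum, map_mul, hσσ, hHik]
  rw [Finset.sum_comm]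
  refine Finset.sum_congr rfl fun i _ => Finset.sum_congr rfl fun k _ => ?_
  ring

/-- **The `H′_v`-value descends**: `p′ᴴ H′_v p′ = ι_v(x₀)` for some `x₀ ∈ L⁺_v` (★ `exists_toLocalRing_eq_of_conjLocal_eq`). [cite: Rogawski1990, §3.8 Prop. 3.8.1 (d) p. 30; §4.3 p. 43] -/
theorem exists_toLocalRing_eq_formValue (hH' : (H'.map (cmConjRingHom L))ᵀ = H') (p' : Fin 3 → UnitaryGroup.LocalRing L v) :
    ∃ x₀ : v.adicCompletion ↥(maximalRealSubfield L), UnitaryGroup.toLocalRing L v x₀ =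
      ∑ i : Fin 3, ∑ k : Fin 3, UnitaryGroup.conjLocal L (IsCMField.complexConj L) v (p' i) *
        ((UnitaryGroup.adelicForm L 3 H').map (UnitaryGroup.adeleToLocal L v)) i k * p' k :=
  exists_toLocalRing_eq_of_conjLocal_eq v (conjLocal_formValue_eq L v H' hH' p')

/-! ## §3 `κ_v = +1` ⇒ the value is non-zero of EVEN order -/

open scoped Classical in
/-- **`κ_v = +1` ⇒ the `H′_v`-value of the eigenvector is NON-ZERO** (a zero value is `z·σz` only for `z = 0`, not a unit, so ★ `finKappaAt_eq_ite_of_eigenvector` would give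
`−1`). [cite: Rogawski1990, §4.3 p. 43; §14.6 p. 242] -/
theorem formValue_ne_zero_of_finKappaAt_eq_one (hv : Subsingleton (UnitaryGroup.PlacesOver L v)) (w : UnitaryGroup.PlacesOver L v)
    (hw : IsCMField.complexConj L • w.1 = w.1) (h : IsLocalNormPair L H' v a b)
    (hu : IsUnit ((finCharpolyTwo L v a).eval (finGammaTwo L v a))) {p' : Fin 3 → UnitaryGroup.LocalRing L v}
    (hp' : (b.val.val : Matrix (Fin 3) (Fin 3) (UnitaryGroup.LocalRing L v)) *ᵥ p' = finGammaTwo L v a • p') (hne : p' ≠ 0)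
    (hκ : finKappaAt L v H' a b = 1) :
    (∑ i : Fin 3, ∑ k : Fin 3, UnitaryGroup.conjLocal L (IsCMField.complexConj L) v (p' i) *
        ((UnitaryGroup.adelicForm L 3 H').map (UnitaryGroup.adeleToLocal L v)) i k * p' k) ≠ 0 := by
  intro h0
  obtain ⟨δ, hcδ, hδ⟩ := exists_complexConj_eq_neg_ne_zero₇ L
  letI : Field (UnitaryGroup.LocalRing L v) :=
    (Liu2021.LemD1IndexedNonVacuityNonsplitPlace.isField_localRing_of_nonsplit L v (IsCMField.complexConj L) hcδ hδ w hw).toField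
  rw [finKappaAt_eq_ite_of_eigenvector L v H' a b hv h hu hp' hne, h0] at hκ
  split_ifs at hκ with hz
  · obtain ⟨z, hzu, hz0⟩ := hz
    rcases mul_eq_zero.1 hz0.symm with hz1 | hz1
    · exact hzu.ne_zero hz1
    · exact hzu.ne_zero (by
        have := congrArg (UnitaryGroup.conjLocal L (IsCMField.complexConj L) v) hz1
        rwa [Liu2021.LemD1OfPlace.conjLocal_conjLocal_apply L v (IsCMField.complexConj L) hcδ hδ, map_zero] at this)

section Unramified

variable (w : UnitaryGroup.PlacesOver L v) (hw : IsCMField.complexConj L • w.1 = w.1)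
  {δ : L} (hcδ : IsCMField.complexConj L δ = -δ) (hδ : δ ≠ 0) {θ : ↥(maximalRealSubfield L)} (hθ : δ * δ = algebraMap ↥(maximalRealSubfield L) L θ)

include hw hcδ hδ hθ in
open scoped Classical in
/-- **`κ_v(γ_H, γ′) = +1` ⇒ `ord_v x₀` IS EVEN** for the `H′_v`-value `x₀ ∈ L⁺_v` of any non-zero `γ₂`-eigenvector `p′` of `γ′` (unramified non-split `v`; contrapositive of ★
`finKappaAt_eq_neg_one_of_nonsplit_of_isUnramifiedIn_of_odd'`) — the «even norm valuation of the `u`-eigenline» that ★ B-p12 `natCard_fixedPoints_unitaryInt_eq_phiTHn_of_eigen`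
consumes (after the congruence to `U(Φ₃)(L_w)`, which preserves the value). [cite: Rogawski1990, §14.6 p. 242; §4.3 p. 43] [cite: Omeara1963, §63C Example 63:16] -/
theorem even_log_valued_of_finKappaAt_eq_one (hunr : Algebra.IsUnramifiedIn (𝓞 L) v.asIdeal) (h : IsLocalNormPair L H' v a b)
    (hu : IsUnit ((finCharpolyTwo L v a).eval (finGammaTwo L v a))) {p' : Fin 3 → UnitaryGroup.LocalRing L v}
    (hp' : (b.val.val : Matrix (Fin 3) (Fin 3) (UnitaryGroup.LocalRing L v)) *ᵥ p' = finGammaTwo L v a • p') (hne : p' ≠ 0)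
    (x₀ : v.adicCompletion ↥(maximalRealSubfield L)) (hx₀ : x₀ ≠ 0)
    (hx : UnitaryGroup.toLocalRing L v x₀ =
      ∑ i : Fin 3, ∑ k : Fin 3, UnitaryGroup.conjLocal L (IsCMField.complexConj L) v (p' i) *
        ((UnitaryGroup.adelicForm L 3 H').map (UnitaryGroup.adeleToLocal L v)) i k * p' k)
    (hκ : finKappaAt L v H' a b = 1) :
    Even (WithZero.log (Valued.v x₀)) := by
  by_contra hodd
  rw [Int.not_even_iff_odd] at hodd
  have h1 := finKappaAt_eq_neg_one_of_nonsplit_of_isUnramifiedIn_of_odd' L v H' a b w hw hcδ hδ hθ hunr h hu hp' hne x₀ hx₀ hx hodd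
  rw [hκ] at h1
  norm_num at h1

end Unramified

end Literature.NumberTheory.Rogawski1990

end
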